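import Literature.Probability.Process.ContinuousOptionalSampling
import Literature.Probability.Process.LevyCharacterisation
import Literature.Probability.Process.ContinuousHitting
import HarnessLib

/-!
# Time change of a martingale clock (Dambis–Dubins–Schwarz, bounded case)

Topic `Probability/Process`; definitions with bodies and proved theorems only (no named fact).
Let `Y` be a bounded continuous strongly adapted process with the martingale clock `c`
(`HasMartingaleClock Y c 𝓕 P N`: `Y` and `Y² − c` a.e. martingales, `c` a `1`-Lipschitz
nondecreasing clock), and let `ρ ≤ T` be a bounded stopping time after which the clock is frozen.
With the **inverse clock** `υ_s = inf{t : c_t ≥ s} ∧ ρ` (`invClock`, stopping times, monotone in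
`s`), the **time-changed process** `Ỹ_s = Y_{υ_s}` (`tcProc`) and the **time-changed filtration**
`𝒢_s = 𝓕_{υ_s}` (`tcFiltration`):

* `HasMartingaleClock.timeChange` — `Ỹ` carries the martingale clock `s ∧ σ`, `σ = c_ρ`
  (`totalClock`), for `𝒢` (optional sampling of the bounded continuous martingales `Y`, `Y² − c`
  at `υ_s ≤ υ_{s'}`, `Process.setIntegral_stoppedValue_eq_of_le`, and `c_{υ_s} = s ∧ σ`,
  `clock_invClockFun`);
* `continuous_tcProc`, `measurable_tcProc`, `measurable_min_totalClock`, `measurable_totalClock`,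
  `tcProc_zero` — the inputs of the Brownian concatenation `isBrownianReal_concat`;
* `tcProc_clock` — undoing the time change, `Ỹ_{c_t} = Y_t` for `t ≤ ρ`, when the clock is
  strictly increasing on `[0, ρ]` (`invClockFun_clock`; also `continuous_invClockFun`).

This is the real-valued, martingale-problem counterpart of the tree's conformal time change
(`Process/ConformalTimeChange`), used for the Schramm–Wilson clock of radial SLE.

## References

* D. Revuz, M. Yor, *Continuous Martingales and Brownian Motion*, 3rd ed. (1999), Ch. V,
  Prop. (1.4), Thm. (1.6), Thm. (1.7). [RevuzYor1999]
* J.-F. Le Gall, *Brownian Motion, Martingales, and Stochastic Calculus* (2016), Thm. 5.13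
  (proof), Cor. 3.23. [Legall2016]
-/

noncomputable section

open MeasureTheory Filter Set Function
open scoped NNReal ENNReal Topology

namespace Literature.Probability.Process

variable {Ω : Type*}

/-! ### The inverse clock -/

section Defs

/-- **The level time** `L_s = inf {t : c_t ≥ s}` of a real clock `c` (`⊤` if the level is never
reached). [cite: Legall2016, Thm. 5.13 (proof)] -/
def clockLevelTime (c : ℝ≥0 → Ω → ℝ) (s : ℝ≥0) : Ω → WithTop ℝ≥0 :=
  hittingAfter c (Ici (s : ℝ)) 0

/-- **The inverse clock capped at `ρ`**: `υ_s = L_s ∧ ρ`. [cite: Legall2016, Thm. 5.13 (proof)] -/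
def invClock (c : ℝ≥0 → Ω → ℝ) (ρ : Ω → ℝ≥0) (s : ℝ≥0) (ω : Ω) : WithTop ℝ≥0 :=
  min (clockLevelTime c s ω) (ρ ω : WithTop ℝ≥0)

/-- The inverse clock as a finite time. [folklore] -/
def invClockFun (c : ℝ≥0 → Ω → ℝ) (ρ : Ω → ℝ≥0) (s : ℝ≥0) (ω : Ω) : ℝ≥0 :=
  (invClock c ρ s ω).untopA

/-- **The time-changed process** `Ỹ_s = Y_{υ_s}`. [cite: RevuzYor1999, Ch. V Thm (1.6)] -/
def tcProc (Y c : ℝ≥0 → Ω → ℝ) (ρ : Ω → ℝ≥0) (s : ℝ≥0) : Ω → ℝ :=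
  stoppedValue Y (invClock c ρ s)

/-- **The total clock** `σ = c_ρ`. [folklore] -/
def totalClock (c : ℝ≥0 → Ω → ℝ) (ρ : Ω → ℝ≥0) (ω : Ω) : ℝ := c (ρ ω) ω

end Defs

section Pathwise

variable {c : ℝ≥0 → Ω → ℝ} {ρ : Ω → ℝ≥0} {Y : ℝ≥0 → Ω → ℝ}

/-- The inverse clock is at most `ρ`. [folklore] -/
theorem invClock_le_rho (s : ℝ≥0) (ω : Ω) : invClock c ρ s ω ≤ (ρ ω : WithTop ℝ≥0) := min_le_right _ _

/-- The inverse clock is finite. [folklore] -/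
theorem invClock_ne_top (s : ℝ≥0) (ω : Ω) : invClock c ρ s ω ≠ ⊤ :=
  ne_top_of_le_ne_top WithTop.coe_ne_top (invClock_le_rho s ω)

/-- `υ_s = invClockFun` as an element of `WithTop`. [folklore] -/
theorem invClock_eq_coe (s : ℝ≥0) (ω : Ω) : invClock c ρ s ω = (invClockFun c ρ s ω : WithTop ℝ≥0) := by
  obtain ⟨a, ha⟩ := WithTop.ne_top_iff_exists.1 (invClock_ne_top (c := c) (ρ := ρ) s ω)
  rw [invClockFun, ← ha, untopA_coe]

/-- `invClockFun ≤ ρ`. [folklore] -/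
theorem invClockFun_le (s : ℝ≥0) (ω : Ω) : invClockFun c ρ s ω ≤ ρ ω := by
  have h := invClock_le_rho (c := c) (ρ := ρ) s ω
  rw [invClock_eq_coe] at h
  exact WithTop.coe_le_coe.1 h

/-- The time-changed process is `Y` read at `invClockFun`. [folklore] -/
theorem tcProc_apply (s : ℝ≥0) (ω : Ω) : tcProc Y c ρ s ω = Y (invClockFun c ρ s ω) ω := rfl

/-- The level time is monotone in the level (continuous clock). [folklore] -/
theorem clockLevelTime_mono (hcc : ∀ ω, Continuous fun t ↦ c t ω) (ω : Ω) {s s' : ℝ≥0} (h : s ≤ s') :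
    clockLevelTime c s ω ≤ clockLevelTime c s' ω := by
  rcases eq_or_ne (clockLevelTime c s' ω) ⊤ with htop | hne
  · rw [htop]; exact le_top
  · obtain ⟨a, ha⟩ := WithTop.ne_top_iff_exists.1 hne
    rw [← ha]
    have hmem : c a ω ∈ Ici (s' : ℝ) := mem_of_hittingAfter_zero_eq_coe isClosed_Ici (hcc ω) ha.symm
    exact hittingAfter_le_of_mem bot_le (show c a ω ∈ Ici (s : ℝ) from (NNReal.coe_le_coe.2 h).trans hmem)

/-- The inverse clock is monotone in the level. [folklore] -/
theorem invClock_mono (hcc : ∀ ω, Continuous fun t ↦ c t ω) (ω : Ω) {s s' : ℝ≥0} (h : s ≤ s') :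
    invClock c ρ s ω ≤ invClock c ρ s' ω :=
  min_le_min_right _ (clockLevelTime_mono hcc ω h)

/-- Pointwise-in-`ω` form of monotonicity. [folklore] -/
theorem invClock_mono' (hcc : ∀ ω, Continuous fun t ↦ c t ω) {s s' : ℝ≥0} (h : s ≤ s') :
    invClock c ρ s ≤ invClock c ρ s' := fun ω ↦ invClock_mono hcc ω h

/-- `invClockFun` is monotone in the level. [folklore] -/
theorem invClockFun_mono (hcc : ∀ ω, Continuous fun t ↦ c t ω) (ω : Ω) {s s' : ℝ≥0} (h : s ≤ s') :
    invClockFun c ρ s ω ≤ invClockFun c ρ s' ω := by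
  have := invClock_mono (c := c) (ρ := ρ) hcc ω h
  rw [invClock_eq_coe, invClock_eq_coe] at this
  exact WithTop.coe_le_coe.1 this

/-- The clock never exceeds the total clock. [folklore] -/
theorem clock_le_totalClock (hmono : ∀ ω, Monotone fun t ↦ c t ω)
    (hfrozen : ∀ t ω, c t ω = c (min t (ρ ω)) ω) (t : ℝ≥0) (ω : Ω) : c t ω ≤ totalClock c ρ ω := by
  rw [hfrozen t ω, totalClock]
  exact hmono ω (min_le_right t (ρ ω))

/-- `υ_0 = 0`. [folklore] -/
theorem invClockFun_zero (hc0 : ∀ ω, c 0 ω = 0) (ω : Ω) : invClockFun c ρ 0 ω = 0 := by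
  have h1 : clockLevelTime c 0 ω ≤ ((0 : ℝ≥0) : WithTop ℝ≥0) :=
    hittingAfter_le_of_mem bot_le (show c 0 ω ∈ Ici ((0 : ℝ≥0) : ℝ) by rw [hc0]; exact self_mem_Ici)
  have h2 : invClock c ρ 0 ω ≤ ((0 : ℝ≥0) : WithTop ℝ≥0) := (min_le_left _ _).trans h1
  rw [invClock_eq_coe] at h2
  exact le_antisymm (WithTop.coe_le_coe.1 h2) bot_le

section ClockAt

variable (hc0 : ∀ ω, c 0 ω = 0) (hcc : ∀ ω, Continuous fun t ↦ c t ω)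
  (hmono : ∀ ω, Monotone fun t ↦ c t ω) (hfrozen : ∀ t ω, c t ω = c (min t (ρ ω)) ω)
include hc0 hcc hmono hfrozen

/-- **The clock at the inverse clock is `s ∧ σ`.** [cite: Legall2016, Thm. 5.13 (proof)] -/
theorem clock_invClockFun (s : ℝ≥0) (ω : Ω) : c (invClockFun c ρ s ω) ω = min (s : ℝ) (totalClock c ρ ω) := by
  have hcont := hcc ω
  by_cases hs : (s : ℝ) ≤ totalClock c ρ ω
  · rw [min_eq_left hs]
    -- the level is reached, at a time `t ≤ ρ` with `c_t = s`
    obtain ⟨t, ht, hts⟩ : ∃ t ∈ Icc (0 : ℝ≥0) (ρ ω), c t ω = s := by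
      have hivt := intermediate_value_Icc (show (0 : ℝ≥0) ≤ ρ ω from bot_le) (hcont.continuousOn (s := Icc 0 (ρ ω)))
      rw [hc0] at hivt
      exact hivt ⟨s.coe_nonneg, hs⟩
    have hmem : c t ω ∈ Ici (s : ℝ) := by rw [hts]; exact self_mem_Ici
    have hlev : clockLevelTime c s ω ≤ t := hittingAfter_le_of_mem bot_le hmem
    have hne : clockLevelTime c s ω ≠ ⊤ := ne_top_of_le_ne_top WithTop.coe_ne_top hlev
    obtain ⟨a, ha⟩ := WithTop.ne_top_iff_exists.1 hne
    have hat : a ≤ t := by rw [← ha] at hlev; exact WithTop.coe_le_coe.1 hlev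
    have haρ : a ≤ ρ ω := hat.trans ht.2
    have hinv : invClockFun c ρ s ω = a := by
      rw [invClockFun, invClock, ← ha, ← WithTop.coe_min, min_eq_left haρ, untopA_coe]
    rw [hinv]
    have h1 : c a ω ∈ Ici (s : ℝ) := mem_of_hittingAfter_zero_eq_coe isClosed_Ici hcont ha.symm
    have h2 : c a ω ≤ s := hts ▸ hmono ω hat
    exact le_antisymm h2 h1
  · rw [not_le] at hs
    rw [min_eq_right hs.le]
    have hlev : clockLevelTime c s ω = ⊤ :=
      hittingAfter_zero_apply_of_forall fun j hj ↦
        not_le.2 hs ((mem_Ici.1 hj).trans (clock_le_totalClock hmono hfrozen j ω))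
    rw [invClockFun, invClock, hlev, min_eq_right le_top, untopA_coe, totalClock]

omit hc0 hcc in
/-- Past the total clock the inverse clock is `ρ`. [folklore] -/
theorem invClockFun_of_totalClock_lt {s : ℝ≥0} {ω : Ω} (hs : totalClock c ρ ω < s) : invClockFun c ρ s ω = ρ ω := by
  have hlev : clockLevelTime c s ω = ⊤ :=
    hittingAfter_zero_apply_of_forall fun j hj ↦
      not_le.2 hs ((mem_Ici.1 hj).trans (clock_le_totalClock hmono hfrozen j ω))
  rw [invClockFun, invClock, hlev, min_eq_right le_top, untopA_coe]

end ClockAt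

/-- **`υ_{c_t} = t` for `t ≤ ρ`** when the clock is strictly increasing on `[0, ρ]`.
[cite: Legall2016, Thm. 5.13 (proof)] -/
theorem invClockFun_clock (hcc : ∀ ω, Continuous fun t ↦ c t ω)
    (hstrict : ∀ ω, StrictMonoOn (fun t ↦ c t ω) (Icc 0 (ρ ω)))
    (hnn : ∀ t ω, 0 ≤ c t ω) {t : ℝ≥0} {ω : Ω} (ht : t ≤ ρ ω) :
    invClockFun c ρ (c t ω).toNNReal ω = t := by
  set s : ℝ≥0 := (c t ω).toNNReal with hs
  have hs' : (s : ℝ) = c t ω := Real.coe_toNNReal _ (hnn t ω)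
  have hmem : c t ω ∈ Ici (s : ℝ) := by rw [hs']; exact self_mem_Ici
  have hlev_le : clockLevelTime c s ω ≤ t := hittingAfter_le_of_mem bot_le hmem
  -- before `t` the clock is below the level
  have hlev_ge : (t : WithTop ℝ≥0) ≤ clockLevelTime c s ω := by
    by_contra hlt
    rw [not_le] at hlt
    obtain ⟨a, ha⟩ := WithTop.ne_top_iff_exists.1 hlt.ne_top
    have hat : a < t := by rw [← ha] at hlt; exact WithTop.coe_lt_coe.1 hlt
    have hca : c a ω ∈ Ici (s : ℝ) := mem_of_hittingAfter_zero_eq_coe isClosed_Ici (hcc ω) ha.symm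
    have hlt' : c a ω < c t ω := hstrict ω ⟨bot_le, hat.le.trans ht⟩ ⟨bot_le, ht⟩ hat
    rw [← hs'] at hlt'
    exact absurd (mem_Ici.1 hca) (not_le.2 hlt')
  have hlev : clockLevelTime c s ω = t := le_antisymm hlev_le hlev_ge
  rw [invClockFun, invClock, hlev, ← WithTop.coe_min, min_eq_left ht, untopA_coe]

/-- **The inverse clock is continuous in the level** (strictly increasing continuous clock on
`[0, ρ]`, constant after). [folklore] -/
theorem continuous_invClockFun (hc0 : ∀ ω, c 0 ω = 0) (hcc : ∀ ω, Continuous fun t ↦ c t ω)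
    (hmono : ∀ ω, Monotone fun t ↦ c t ω)
    (hstrict : ∀ ω, StrictMonoOn (fun t ↦ c t ω) (Icc 0 (ρ ω))) (ω : Ω) :
    Continuous fun s ↦ invClockFun c ρ s ω := by
  have hnn : ∀ t ω, 0 ≤ c t ω := fun t ω ↦ by rw [← hc0 ω]; exact hmono ω bot_le
  set υ : ℝ≥0 → ℝ≥0 := fun s ↦ invClockFun c ρ s ω with hυ
  have hυmono : Monotone υ := fun s s' h ↦ invClockFun_mono hcc ω h
  have hυle : ∀ s, υ s ≤ ρ ω := fun s ↦ invClockFun_le s ω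
  have hυc : ∀ t, t ≤ ρ ω → υ (c t ω).toNNReal = t := fun t ht ↦ invClockFun_clock hcc hstrict hnn ht
  -- the range of `υ` is `[0, ρ]`
  have hrange : υ '' univ = Iic (ρ ω) := by
    refine Subset.antisymm ?_ fun t ht ↦ ⟨(c t ω).toNNReal, mem_univ _, hυc t ht⟩
    rintro _ ⟨s, -, rfl⟩
    exact hυle s
  have hυmono' : MonotoneOn υ univ := hυmono.monotoneOn _
  refine continuous_iff_continuousAt.2 fun s₀ ↦ continuousAt_iff_continuous_left_right.2 ⟨?_, ?_⟩
  · -- left continuity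
    refine continuousWithinAt_left_of_monotoneOn_of_image_mem_nhdsWithin hυmono' univ_mem ?_
    rw [hrange]
    exact mem_of_superset self_mem_nhdsWithin fun t ht ↦ (mem_Iic.1 ht).trans (hυle s₀)
  · -- right continuity
    rcases lt_or_eq_of_le (hυle s₀) with hlt | heq
    · refine continuousWithinAt_right_of_monotoneOn_of_image_mem_nhdsWithin hυmono' univ_mem ?_
      rw [hrange]
      exact mem_of_superset (Icc_mem_nhdsGE hlt) Icc_subset_Iic_self
    · -- `υ` is constant `ρ` to the right of `s₀`
      have hev : (fun s ↦ υ s) =ᶠ[𝓝[≥] s₀] fun _ ↦ ρ ω := by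
        filter_upwards [self_mem_nhdsWithin] with s hs
        exact le_antisymm (hυle s) (heq ▸ hυmono hs)
      exact (continuousWithinAt_const.congr_of_eventuallyEq hev heq).congr (fun _ _ ↦ rfl) rfl

end Pathwise

/-! ### Continuity of a martingale clock -/

section ClockContinuity

variable {m : MeasurableSpace Ω} {𝓕 : Filtration ℝ≥0 m} {P : Measure Ω} {Y c : ℝ≥0 → Ω → ℝ} {N : ℝ}

/-- A martingale clock is `1`-Lipschitz, hence continuous, in time. [folklore] -/
theorem HasMartingaleClock.continuous_clock (h : HasMartingaleClock Y c 𝓕 P N) (ω : Ω) :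
    Continuous fun t ↦ c t ω := by
  refine (LipschitzWith.of_dist_le_mul (K := 1) fun t s ↦ ?_).continuous
  rw [NNReal.coe_one, one_mul, Real.dist_eq, NNReal.dist_eq]
  rcases le_total s t with hst | hts
  · rw [abs_of_nonneg (sub_nonneg.2 (h.clock_mono ω hst)), abs_of_nonneg (sub_nonneg.2 (NNReal.coe_le_coe.2 hst))]
    exact h.clock_sub_le ω hst
  · rw [abs_sub_comm, abs_of_nonneg (sub_nonneg.2 (h.clock_mono ω hts)), abs_sub_comm,
      abs_of_nonneg (sub_nonneg.2 (NNReal.coe_le_coe.2 hts))]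
    exact h.clock_sub_le ω hts

/-- A martingale clock is monotone in time. [folklore] -/
theorem HasMartingaleClock.monotone_clock (h : HasMartingaleClock Y c 𝓕 P N) (ω : Ω) :
    Monotone fun t ↦ c t ω := fun _ _ hst ↦ h.clock_mono ω hst

/-- **An a.e. martingale which is strongly adapted is a martingale.** [folklore] -/
theorem HasMartingaleClock.martingale (h : HasMartingaleClock Y c 𝓕 P N)
    (hYad : StronglyAdapted 𝓕 Y) : Martingale Y 𝓕 P :=
  ⟨hYad, h.isAEMartingale.condExp_ae_eq⟩

/-- The compensated square is a martingale (strongly adapted case). [folklore] -/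
theorem HasMartingaleClock.martingale_sq_sub (h : HasMartingaleClock Y c 𝓕 P N)
    (hYad : StronglyAdapted 𝓕 Y) (hcad : Adapted 𝓕 c) :
    Martingale (fun t ω ↦ Y t ω ^ 2 - c t ω) 𝓕 P :=
  ⟨fun t ↦ ((hYad t).pow 2).sub (hcad t).stronglyMeasurable, h.isAEMartingale_sq_sub.condExp_ae_eq⟩

end ClockContinuity

/-! ### The time-changed filtration and measurability -/

section Filtration

variable {m : MeasurableSpace Ω} {𝓕 : Filtration ℝ≥0 m} {c : ℝ≥0 → Ω → ℝ} {ρ : Ω → ℝ≥0} {Y : ℝ≥0 → Ω → ℝ}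

/-- The level times are stopping times (continuous adapted clock, closed level set). [folklore] -/
theorem isStoppingTime_clockLevelTime (hcad : Adapted 𝓕 c) (hcc : ∀ ω, Continuous fun t ↦ c t ω) (s : ℝ≥0) :
    IsStoppingTime 𝓕 (clockLevelTime c s) :=
  isStoppingTime_hittingAfter_of_continuous hcad hcc isClosed_Ici

/-- **The inverse clock is a stopping time.** [cite: Legall2016, Thm. 5.13 (proof)] -/
theorem isStoppingTime_invClock (hcad : Adapted 𝓕 c) (hcc : ∀ ω, Continuous fun t ↦ c t ω)
    (hρ : IsStoppingTime 𝓕 fun ω ↦ (ρ ω : WithTop ℝ≥0)) (s : ℝ≥0) : IsStoppingTime 𝓕 (invClock c ρ s) :=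
  (isStoppingTime_clockLevelTime hcad hcc s).min hρ

/-- **The time-changed filtration** `𝒢_s = 𝓕_{υ_s}`. [cite: RevuzYor1999, Ch. V Thm (1.6)] -/
def tcFiltration (hcad : Adapted 𝓕 c) (hcc : ∀ ω, Continuous fun t ↦ c t ω)
    (hρ : IsStoppingTime 𝓕 fun ω ↦ (ρ ω : WithTop ℝ≥0)) : Filtration ℝ≥0 m where
  seq s := (isStoppingTime_invClock hcad hcc hρ s).measurableSpace
  mono' _ _ h := IsStoppingTime.measurableSpace_mono _ _ (invClock_mono' hcc h)
  le' _ := IsStoppingTime.measurableSpace_le _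

section

variable (hcad : Adapted 𝓕 c) (hcc : ∀ ω, Continuous fun t ↦ c t ω)
  (hρ : IsStoppingTime 𝓕 fun ω ↦ (ρ ω : WithTop ℝ≥0))
include hcad hcc

/-- The clock is progressive. [folklore] -/
theorem isStronglyProgressive_adaptedClock : IsStronglyProgressive 𝓕 c :=
  StronglyAdapted.isStronglyProgressive_of_continuous (fun t ↦ (hcad t).stronglyMeasurable) hcc

include hρ

/-- Unfolding of the time-changed filtration. [folklore] -/
theorem tcFiltration_apply (s : ℝ≥0) :
    (tcFiltration hcad hcc hρ s : MeasurableSpace Ω) = (isStoppingTime_invClock hcad hcc hρ s).measurableSpace := rfl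

/-- **The time-changed process is adapted to the time-changed filtration.**
[cite: RevuzYor1999, Ch. V Prop (1.4)] -/
theorem measurable_tcProc (hYprog : IsStronglyProgressive 𝓕 Y) (s : ℝ≥0) :
    Measurable[tcFiltration hcad hcc hρ s] (tcProc Y c ρ s) :=
  measurable_stoppedValue hYprog (isStoppingTime_invClock hcad hcc hρ s)

/-- The clock sampled at the inverse clock is `𝒢_s`-measurable. [folklore] -/
theorem measurable_stoppedValue_clock (s : ℝ≥0) :
    Measurable[tcFiltration hcad hcc hρ s] (stoppedValue c (invClock c ρ s)) :=
  measurable_stoppedValue (isStronglyProgressive_adaptedClock hcad hcc) (isStoppingTime_invClock hcad hcc hρ s)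

/-- **The time-changed clock `s ∧ σ` is `𝒢_s`-measurable.** [folklore] -/
theorem measurable_min_totalClock (hc0 : ∀ ω, c 0 ω = 0) (hmono : ∀ ω, Monotone fun t ↦ c t ω)
    (hfrozen : ∀ t ω, c t ω = c (min t (ρ ω)) ω) (s : ℝ≥0) :
    Measurable[tcFiltration hcad hcc hρ s] fun ω ↦ min (s : ℝ) (totalClock c ρ ω) := by
  have heq : (fun ω ↦ min (s : ℝ) (totalClock c ρ ω)) = stoppedValue c (invClock c ρ s) := by
    funext ω
    rw [← clock_invClockFun hc0 hcc hmono hfrozen s ω, stoppedValue, invClockFun]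
  rw [heq]
  exact measurable_stoppedValue_clock hcad hcc hρ s

/-- The total clock is measurable. [folklore] -/
theorem measurable_totalClock : Measurable (totalClock c ρ) := by
  have h1 : Measurable[hρ.measurableSpace] (stoppedValue c fun ω ↦ (ρ ω : WithTop ℝ≥0)) :=
    measurable_stoppedValue (isStronglyProgressive_adaptedClock hcad hcc) hρ
  exact h1.mono hρ.measurableSpace_le le_rfl

end

end Filtration

/-! ### The time change theorem -/

section TimeChange

variable {m : MeasurableSpace Ω} {𝓕 : Filtration ℝ≥0 m} {P : Measure Ω} {Y c : ℝ≥0 → Ω → ℝ} {ρ : Ω → ℝ≥0}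
  {N : ℝ} {T : ℝ≥0}

/-- `min s σ' - min s σ ≤ s' - s`-type inequality for the time-changed clock. [folklore] -/
theorem min_sub_min_le_sub {s s' σ : ℝ} (h : s ≤ s') : min s' σ - min s σ ≤ s' - s := by
  rcases le_total s σ with h1 | h1 <;> rcases le_total s' σ with h2 | h2
  · rw [min_eq_left h1, min_eq_left h2]
  · rw [min_eq_left h1, min_eq_right h2]; linarith
  · rw [min_eq_right h1, min_eq_left h2]; linarith
  · rw [min_eq_right h1, min_eq_right h2]; linarith

/-- **Time change of a martingale clock (Dambis–Dubins–Schwarz, bounded case).** Let `Y` be a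
strongly adapted process with continuous paths carrying the martingale clock `c`
(`HasMartingaleClock Y c 𝓕 P N`), let `ρ ≤ T` be a bounded stopping time after which the clock is
frozen and before which it is strictly increasing. Then the time-changed process
`Ỹ_s = Y_{υ_s}`, `υ_s = inf{t : c_t ≥ s} ∧ ρ`, carries the martingale clock `s ∧ σ`, `σ = c_ρ`,
for the time-changed filtration `𝒢_s = 𝓕_{υ_s}`: `Ỹ` and `Ỹ² - s ∧ σ` are `𝒢`-martingales
(optional sampling of the bounded continuous martingales `Y`, `Y² - c` at the stopping times
`υ_s ≤ υ_{s'} ≤ T`, `Process.setIntegral_stoppedValue_eq_of_le`, and `c_{υ_s} = s ∧ σ`).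
Revuz–Yor (1999), Ch. V, Prop. (1.4)–Thm. (1.6); Le Gall (2016), Thm. 5.13 (proof).
[cite: RevuzYor1999, Ch. V Thm (1.6)] -/
theorem HasMartingaleClock.timeChange [IsProbabilityMeasure P]
    (h : HasMartingaleClock Y c 𝓕 P N) (hYad : StronglyAdapted 𝓕 Y) (hYc : ∀ ω, Continuous (Y · ω))
    (hcad : Adapted 𝓕 c) (hρ : IsStoppingTime 𝓕 fun ω ↦ (ρ ω : WithTop ℝ≥0)) (hρT : ∀ ω, ρ ω ≤ T)
    (hfrozen : ∀ t ω, c t ω = c (min t (ρ ω)) ω) :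
    HasMartingaleClock (tcProc Y c ρ) (fun s ω ↦ min (s : ℝ) (totalClock c ρ ω))
      (tcFiltration hcad h.continuous_clock hρ) P N := by
  have hcc := h.continuous_clock
  have hc0 := h.clock_zero
  have hmono := h.monotone_clock
  set 𝒢 := tcFiltration hcad hcc hρ with h𝒢
  have hYprog : IsStronglyProgressive 𝓕 Y := hYad.isStronglyProgressive_of_continuous hYc
  have hinv : ∀ s, IsStoppingTime 𝓕 (invClock c ρ s) := isStoppingTime_invClock hcad hcc hρ
  have hfin : ∀ s, ∀ᵐ ω ∂P, invClock c ρ s ω ≠ ⊤ := fun s ↦ ae_of_all _ fun ω ↦ invClock_ne_top s ω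
  -- the two bounded continuous martingales
  have hM1 : Martingale Y 𝓕 P := h.martingale hYad
  have hM2 : Martingale (fun t ω ↦ Y t ω ^ 2 - c t ω) 𝓕 P := h.martingale_sq_sub hYad hcad
  have hM1c : ∀ᵐ ω ∂P, Continuous (Y · ω) := ae_of_all _ hYc
  have hM2c : ∀ᵐ ω ∂P, Continuous fun t ↦ Y t ω ^ 2 - c t ω :=
    ae_of_all _ fun ω ↦ ((hYc ω).pow 2).sub (hcc ω)
  -- bounds of the stopped processes at the inverse clocks
  have hcT : ∀ (s : ℝ≥0) (n : ℕ) ω, |c ((min (n : WithTop ℝ≥0) (invClock c ρ s ω)).untopA) ω| ≤ T := by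
    intro s n ω
    rw [abs_of_nonneg (h.clock_nonneg ω _)]
    refine (h.clock_le ω _).trans ?_
    have h1 : (min (n : WithTop ℝ≥0) (invClock c ρ s ω)).untopA ≤ invClockFun c ρ s ω := by
      rw [invClock_eq_coe]
      have : (min ((n : ℝ≥0) : WithTop ℝ≥0) (invClockFun c ρ s ω : WithTop ℝ≥0)).untopA =
          min (n : ℝ≥0) (invClockFun c ρ s ω) := untopA_min_coe_coe _ _
      rw [show ((n : ℕ) : WithTop ℝ≥0) = ((n : ℝ≥0) : WithTop ℝ≥0) from rfl, this]
      exact min_le_right _ _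
    exact_mod_cast h1.trans ((invClockFun_le s ω).trans (hρT ω))
  have hB1 : ∀ s s' : ℝ≥0, ∀ᵐ ω ∂P, ∀ n : ℕ, |stoppedProcess Y (invClock c ρ s') n ω| ≤ N ∧
      |stoppedProcess Y (invClock c ρ s) n ω| ≤ N := by
    intro s s'
    filter_upwards [h.abs_le] with ω hω n
    exact ⟨hω _, hω _⟩
  have hB2 : ∀ s s' : ℝ≥0, ∀ᵐ ω ∂P, ∀ n : ℕ,
      |stoppedProcess (fun t ω ↦ Y t ω ^ 2 - c t ω) (invClock c ρ s') n ω| ≤ N ^ 2 + T ∧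
      |stoppedProcess (fun t ω ↦ Y t ω ^ 2 - c t ω) (invClock c ρ s) n ω| ≤ N ^ 2 + T := by
    intro s s'
    filter_upwards [h.abs_le] with ω hω n
    have key : ∀ s : ℝ≥0, |stoppedProcess (fun t ω ↦ Y t ω ^ 2 - c t ω) (invClock c ρ s) n ω| ≤ N ^ 2 + T := by
      intro s
      simp only [stoppedProcess]
      have h1 := hω ((min (n : WithTop ℝ≥0) (invClock c ρ s ω)).untopA)
      have h2 := hcT s n ω
      have h3 : |Y ((min (n : WithTop ℝ≥0) (invClock c ρ s ω)).untopA) ω ^ 2| ≤ N ^ 2 := by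
        rw [abs_pow]; exact pow_le_pow_left₀ (abs_nonneg _) h1 2
      exact (abs_sub _ _).trans (add_le_add h3 h2)
    exact ⟨key s', key s⟩
  -- measurability and integrability of the time-changed processes
  have hYm : ∀ s, Measurable[𝒢 s] (tcProc Y c ρ s) := measurable_tcProc hcad hcc hρ hYprog
  have hCm : ∀ s, Measurable[𝒢 s] fun ω ↦ min (s : ℝ) (totalClock c ρ ω) :=
    measurable_min_totalClock hcad hcc hρ hc0 hmono hfrozen
  have hYbdd : ∀ s, ∀ᵐ ω ∂P, |tcProc Y c ρ s ω| ≤ N := fun s ↦ by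
    filter_upwards [h.abs_le] with ω hω
    exact hω _
  have hσ0 : ∀ ω, 0 ≤ totalClock c ρ ω := fun ω ↦ h.clock_nonneg ω _
  have hσT : ∀ ω, totalClock c ρ ω ≤ T := fun ω ↦ (h.clock_le ω _).trans (by exact_mod_cast hρT ω)
  have hYint : ∀ s, Integrable (tcProc Y c ρ s) P := fun s ↦
    Integrable.mono' (integrable_const N) ((hYm s).mono (𝒢.le s) le_rfl).aestronglyMeasurable
      ((hYbdd s).mono fun ω hω ↦ by rw [Real.norm_eq_abs]; exact hω)
  set S2 : ℝ≥0 → Ω → ℝ := fun s ω ↦ tcProc Y c ρ s ω ^ 2 - min (s : ℝ) (totalClock c ρ ω) with hS2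
  have hS2m : ∀ s, Measurable[𝒢 s] (S2 s) := fun s ↦ ((hYm s).pow_const 2).sub (hCm s)
  have hS2int : ∀ s, Integrable (S2 s) P := fun s ↦ by
    refine Integrable.mono' (integrable_const (N ^ 2 + T)) ((hS2m s).mono (𝒢.le s) le_rfl).aestronglyMeasurable ?_
    filter_upwards [hYbdd s] with ω hω
    rw [Real.norm_eq_abs]
    have h3 : |tcProc Y c ρ s ω ^ 2| ≤ N ^ 2 := by rw [abs_pow]; exact pow_le_pow_left₀ (abs_nonneg _) hω 2
    have h4 : |min (s : ℝ) (totalClock c ρ ω)| ≤ T := by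
      rw [abs_of_nonneg (le_min s.coe_nonneg (hσ0 ω))]
      exact (min_le_right _ _).trans (hσT ω)
    exact (abs_sub _ _).trans (add_le_add h3 h4)
  -- the stopped value of `Y² - c` at `υ_s` is `S2 s`
  have hS2eq : ∀ s ω, S2 s ω = stoppedValue (fun t ω ↦ Y t ω ^ 2 - c t ω) (invClock c ρ s) ω := by
    intro s ω
    simp only [hS2, tcProc, stoppedValue]
    rw [← clock_invClockFun hc0 hcc hmono hfrozen s ω, invClockFun]
  -- optional sampling
  have hos1 : ∀ s s' : ℝ≥0, s ≤ s' → ∀ A, MeasurableSet[𝒢 s] A →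
      ∫ ω in A, tcProc Y c ρ s' ω ∂P = ∫ ω in A, tcProc Y c ρ s ω ∂P := by
    intro s s' hss' A hA
    exact setIntegral_stoppedValue_eq_of_le hM1 hM1c (hinv s) (hinv s') (invClock_mono' hcc hss') (hfin s')
      (hB1 s s') hA
  have hos2 : ∀ s s' : ℝ≥0, s ≤ s' → ∀ A, MeasurableSet[𝒢 s] A →
      ∫ ω in A, S2 s' ω ∂P = ∫ ω in A, S2 s ω ∂P := by
    intro s s' hss' A hA
    have h1 := setIntegral_stoppedValue_eq_of_le hM2 hM2c (hinv s) (hinv s') (invClock_mono' hcc hss') (hfin s')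
      (hB2 s s') hA
    rw [setIntegral_congr_fun ((𝒢.le s) _ hA) (fun ω _ ↦ hS2eq s' ω),
      setIntegral_congr_fun ((𝒢.le s) _ hA) (fun ω _ ↦ hS2eq s ω)]
    exact h1
  -- the martingale properties
  have hmart1 : IsAEMartingale (tcProc Y c ρ) 𝒢 P := by
    refine ⟨fun s ↦ (hYm s).stronglyMeasurable.aestronglyMeasurable, fun s s' hss' ↦ ?_⟩
    symm
    exact ae_eq_condExp_of_forall_setIntegral_eq (𝒢.le s) (hYint s')
      (fun A _ _ ↦ (hYint s).integrableOn) (fun A hA _ ↦ (hos1 s s' hss' A hA).symm)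
      (hYm s).stronglyMeasurable.aestronglyMeasurable
  have hmart2 : IsAEMartingale S2 𝒢 P := by
    refine ⟨fun s ↦ (hS2m s).stronglyMeasurable.aestronglyMeasurable, fun s s' hss' ↦ ?_⟩
    symm
    exact ae_eq_condExp_of_forall_setIntegral_eq (𝒢.le s) (hS2int s')
      (fun A _ _ ↦ (hS2int s).integrableOn) (fun A hA _ ↦ (hos2 s s' hss' A hA).symm)
      (hS2m s).stronglyMeasurable.aestronglyMeasurable
  exact
    { isAEMartingale := hmart1
      isAEMartingale_sq_sub := hmart2
      clock_zero := fun ω ↦ by simp only [NNReal.coe_zero, min_eq_left (hσ0 ω)]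
      clock_mono := fun ω s s' hss' ↦ min_le_min_right _ (NNReal.coe_le_coe.2 hss')
      clock_sub_le := fun ω s s' hss' ↦ min_sub_min_le_sub (NNReal.coe_le_coe.2 hss')
      abs_le := by
        filter_upwards [h.abs_le] with ω hω s
        exact hω _ }

/-- **The time-changed process has continuous paths** (strictly increasing clock before `ρ`).
[folklore] -/
theorem continuous_tcProc (hYc : ∀ ω, Continuous (Y · ω)) (hc0 : ∀ ω, c 0 ω = 0)
    (hcc : ∀ ω, Continuous fun t ↦ c t ω) (hmono : ∀ ω, Monotone fun t ↦ c t ω)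
    (hstrict : ∀ ω, StrictMonoOn (fun t ↦ c t ω) (Icc 0 (ρ ω))) (ω : Ω) :
    Continuous fun s ↦ tcProc Y c ρ s ω :=
  (hYc ω).comp (continuous_invClockFun hc0 hcc hmono hstrict ω)

/-- The time-changed process starts where `Y` does. [folklore] -/
theorem tcProc_zero (hc0 : ∀ ω, c 0 ω = 0) (ω : Ω) : tcProc Y c ρ 0 ω = Y 0 ω := by
  rw [tcProc_apply, invClockFun_zero hc0]

/-- **Undoing the time change**: `Ỹ_{c_t} = Y_t` for `t ≤ ρ` (strictly increasing clock).
[cite: RevuzYor1999, Ch. V Thm (1.6)] -/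
theorem tcProc_clock (hcc : ∀ ω, Continuous fun t ↦ c t ω)
    (hstrict : ∀ ω, StrictMonoOn (fun t ↦ c t ω) (Icc 0 (ρ ω))) (hnn : ∀ t ω, 0 ≤ c t ω)
    {t : ℝ≥0} {ω : Ω} (ht : t ≤ ρ ω) : tcProc Y c ρ (c t ω).toNNReal ω = Y t ω := by
  rw [tcProc_apply, invClockFun_clock hcc hstrict hnn ht]

end TimeChange

end Literature.Probability.Process
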